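import Summits.Ventures.PercRepro.S1CoreCapEightExactFinal

/-!
# PercRepro — THE AVERAGING CHAIN FROM THE EXACT `s₄ ≤ 87`, EXPLICIT (p1, gen 29)

The averaging recursion of `S1CoreCapAvg` (`ncard_fourCircuits_sub_div_le` + `le_mul_div_of_sub_div_le`:
`s₄ ≤ ⌊(d + 6) · B / (d + 2)⌋` at nullity `d + 1` from `s₄ ≤ B` at nullity `d`) iterated from the exact instance,
value by value and without a new definition: from `87` at nullity `8` (`S1CoreCapEightExactFinal`) and `121`
at nullity `9`, `s₄ ≤ 165` at nullity `10` (`ncard_fourCircuits_le_one_hundred_sixty_five`, from `169`), `220`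
at `11` (`…_two_hundred_twenty`, from `225`), `287` at `12` (`…_two_hundred_eighty_seven`, from `294`), `369`
at `13` (`…_three_hundred_sixty_nine`, from `378`) — the `s₄` chain `64, 87, 121, 165, 220, 287, 369` at
`ν = 7, …, 13` of the pricings (`proofs/P1-S4-CAPBRIDGE.md` §21). Axioms: standard.
-/

open scoped Matroid

namespace PercRepro

namespace S1

open Set

open FourCap

variable {α : Type}

/-- **`s₄ ≤ 165` on every e-free core of nullity `10`** (from `169`): `⌊15 · 121 / 11⌋ = 165`. -/
theorem ncard_fourCircuits_le_one_hundred_sixty_five (M : Matroid α) [M.Finite]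
    (hfree : ∀ e ∈ M.E, ∃ A ⊆ M.E \ {e}, e ∉ M.closure A ∧ e ∉ M.closure ((M.E \ {e}) \ A))
    (hd : M.E.encard = M.eRank + 10) : {C : Set α | M.IsCircuit C ∧ C.ncard = 4}.ncard ≤ 165 := by
  have h := ncard_fourCircuits_sub_div_le M hfree (d := 9) hd (by omega)
    (fun M' _ hfree' hd' => ncard_fourCircuits_le_one_hundred_twenty_one M' hfree' hd')
  exact le_mul_div_of_sub_div_le (m := 9 + 6) (by omega) h

/-- **`s₄ ≤ 220` on every e-free core of nullity `11`** (from `225`): `⌊16 · 165 / 12⌋ = 220`. -/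
theorem ncard_fourCircuits_le_two_hundred_twenty (M : Matroid α) [M.Finite]
    (hfree : ∀ e ∈ M.E, ∃ A ⊆ M.E \ {e}, e ∉ M.closure A ∧ e ∉ M.closure ((M.E \ {e}) \ A))
    (hd : M.E.encard = M.eRank + 11) : {C : Set α | M.IsCircuit C ∧ C.ncard = 4}.ncard ≤ 220 := by
  have h := ncard_fourCircuits_sub_div_le M hfree (d := 10) hd (by omega)
    (fun M' _ hfree' hd' => ncard_fourCircuits_le_one_hundred_sixty_five M' hfree' hd')
  exact le_mul_div_of_sub_div_le (m := 10 + 6) (by omega) h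

/-- **`s₄ ≤ 287` on every e-free core of nullity `12`** (from `294`): `⌊17 · 220 / 13⌋ = 287`. -/
theorem ncard_fourCircuits_le_two_hundred_eighty_seven (M : Matroid α) [M.Finite]
    (hfree : ∀ e ∈ M.E, ∃ A ⊆ M.E \ {e}, e ∉ M.closure A ∧ e ∉ M.closure ((M.E \ {e}) \ A))
    (hd : M.E.encard = M.eRank + 12) : {C : Set α | M.IsCircuit C ∧ C.ncard = 4}.ncard ≤ 287 := by
  have h := ncard_fourCircuits_sub_div_le M hfree (d := 11) hd (by omega)
    (fun M' _ hfree' hd' => ncard_fourCircuits_le_two_hundred_twenty M' hfree' hd')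
  exact le_mul_div_of_sub_div_le (m := 11 + 6) (by omega) h

/-- **`s₄ ≤ 369` on every e-free core of nullity `13`** (from `378`): `⌊18 · 287 / 14⌋ = 369`. -/
theorem ncard_fourCircuits_le_three_hundred_sixty_nine (M : Matroid α) [M.Finite]
    (hfree : ∀ e ∈ M.E, ∃ A ⊆ M.E \ {e}, e ∉ M.closure A ∧ e ∉ M.closure ((M.E \ {e}) \ A))
    (hd : M.E.encard = M.eRank + 13) : {C : Set α | M.IsCircuit C ∧ C.ncard = 4}.ncard ≤ 369 := by
  have h := ncard_fourCircuits_sub_div_le M hfree (d := 12) hd (by omega)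
    (fun M' _ hfree' hd' => ncard_fourCircuits_le_two_hundred_eighty_seven M' hfree' hd')
  exact le_mul_div_of_sub_div_le (m := 12 + 6) (by omega) h

end S1

end PercRepro
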